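import Mathlib.NumberTheory.LSeries.RiemannZeta
import Mathlib.NumberTheory.Harmonic.ZetaAsymp
import Literature.Analysis.ValidatedNumerics.Certificate
import HarnessLib

-- provenance: harness21/H21/H21/Prelude/DiophValNum/NamedHypotheses.lean @ 93a4f70 (interim HEAD d8f2665); M5 mechanical rewrite
/-!
# Named numerical hypotheses (trunk DiophValNum / T-VALNUM, item G22)

The T-VALNUM design rule (TRUNKS §28, design 1): large computer-assisted numerical facts enter
H21 statements as *named hypotheses* — a `def FooUpTo (T) : Prop` taken as an explicit
hypothesis downstream — never as axioms. This file instantiates the pattern on its canonical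
example, "the Riemann hypothesis has been verified up to height `T`"
(D. Platt, T. Trudgian, *The Riemann hypothesis is true up to `3 · 10¹²`*, Bull. LMS 53 (2021),
792–797, Theorem 1; bib key `PlattTrudgianBLMS2021`, doi 10.1112/blms.12460, arXiv:2004.09765).

## Contents

* `Literature.NumberTheory.DiophantineGeometry.RiemannHypothesisUpTo T`: every zero `s` of `riemannZeta` with `0 < im s ≤ T` has
  `re s = 1/2` (exactly the shape of the accepted statement rh.S35,
  `Literature.NumberTheory.LFunctions.platt_trudgian_numerical_rh` in `Literature/NumberTheory/LFunctions/RHWave0.lean`).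
* `Literature.NumberTheory.DiophantineGeometry.riemannHypothesisUpTo_anti`, `Literature.NumberTheory.DiophantineGeometry.RiemannHypothesisUpTo.mono_of_le`: monotonicity in `T`.
* `Literature.NumberTheory.DiophantineGeometry.RiemannHypothesisUpTo.of_riemannHypothesis`: Mathlib's `RiemannHypothesis` implies every
  `RiemannHypothesisUpTo T` (real proof).
* `Literature.NumberTheory.DiophantineGeometry.riemannHypothesis_of_forall_riemannHypothesisUpTo`: the converse, as a named fact (it needs
  the conjugation symmetry `riemannZeta_conj` and the absence of real zeros of `ζ` in `[0, 1]`);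
  discharged in `NamedHypothesesRHProofs.lean` (`riemannHypothesis_of_forall_riemannHypothesisUpTo_holds`,
  `riemannHypothesis_iff_forall_riemannHypothesisUpTo_holds`).
* `Literature.NumberTheory.DiophantineGeometry.riemannHypothesisUpTo_platt_trudgian`: the Platt–Trudgian instance `T = 3000175332800`
  (restating rh.S35 without its id, see the docstring). Size XL (a 7.5-million-core-hour
  ball-arithmetic computation, §2 of the source); the analytic reduction to its count form
  `zetaZeroCount_platt_trudgian` is proved in `NamedHypothesesProofs.lean`
  (`riemannHypothesisUpTo_platt_trudgian_of_zeroCount`, Turing's method in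
  `Literature/NumberTheory/LFunctions/TuringMethod.lean`).
* `Literature.NumberTheory.DiophantineGeometry.RHVerifier`, `Literature.NumberTheory.DiophantineGeometry.riemannHypothesisUpTo_of_check`: the certificate form
  (`Literature.Analysis.ValidatedNumerics.Verifier` of `Literature/Analysis/ValidatedNumerics/Certificate.lean`), i.e. the route by which the named
  hypothesis is discharged by a verified checker. One such checker now exists: Backlund's method,
  `Literature.NumberTheory.LFunctions.ZetaCert.backlundVerifier` with the kernel-checked certificate
  for `T = 16` (`Literature.NumberTheory.LFunctions.riemannHypothesisUpTo_sixteen`,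
  `Literature/NumberTheory/LFunctions/ZetaArgumentCertificate.lean`); the Platt–Trudgian height
  (`1.2 · 10¹³` zeros) is far outside kernel evaluation.

## Mathlib

Mathlib has `riemannZeta`, `RiemannHypothesis` (`Mathlib/NumberTheory/LSeries/RiemannZeta.lean`)
and `riemannZeta_conj` (`Mathlib/NumberTheory/Harmonic/ZetaAsymp.lean`); it has no "RH up to
height `T`" predicate (searched `RiemannHypothesis`, `UpTo`), which is defined here.

## Design notes

* Only the upper half-strip `0 < im s ≤ T` is constrained, as in rh.S35: by `riemannZeta_conj`
  the zeros with `-T ≤ im s < 0` are the conjugates of those with `0 < im s ≤ T`, and a zero with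
  `im s ≠ 0` is automatically not a trivial zero `-2(n+1)` and not the pole `1`.
* This file is kept import-light (two Mathlib files and the certificate interface; it does not
  import `RHWave0.lean`, which imports all of Mathlib), hence the syntactic restatement
  `riemannHypothesisUpTo_platt_trudgian` of rh.S35, which carries no statement id; the two are
  the same proposition (`Iff.rfl`).
-/

namespace Literature.NumberTheory.DiophantineGeometry

/-! ### RH up to height `T` -/

/-- **The Riemann hypothesis up to height `T`**: every zero `s` of `riemannZeta` with
`0 < im s ≤ T` lies on the critical line `re s = 1/2`. By `riemannZeta_conj` this also controls
the zeros with `-T ≤ im s < 0`, and zeros with `im s ≠ 0` are automatically non-trivial (the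
trivial zeros `-2(n+1)` and the pole `1` are real). This is the named-hypothesis form of
numerical RH verifications (Platt–Trudgian, Bull. LMS 53 (2021), Thm. 1, for
`T = 3 000 175 332 800`; TRUNKS §28 design 1). [folklore] -/
def RiemannHypothesisUpTo (T : ℝ) : Prop :=
  ∀ s : ℂ, riemannZeta s = 0 → 0 < s.im → s.im ≤ T → s.re = 1 / 2

/-- `RiemannHypothesisUpTo` is antitone in the height: verifying RH up to a larger height is a
stronger statement (immediate from the definition). [folklore] -/
theorem riemannHypothesisUpTo_anti : Antitone RiemannHypothesisUpTo :=
  fun _ _ hTT' h s hs h0 hT ↦ h s hs h0 (hT.trans hTT')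

/-- Pointwise form of `riemannHypothesisUpTo_anti`: RH up to height `T` implies RH up to any
smaller height `T' ≤ T`. [folklore] -/
theorem RiemannHypothesisUpTo.mono_of_le {T T' : ℝ} (h : T' ≤ T) :
    RiemannHypothesisUpTo T → RiemannHypothesisUpTo T' :=
  riemannHypothesisUpTo_anti h

/-- Mathlib's `RiemannHypothesis` implies `RiemannHypothesisUpTo T` for every `T`: a zero with
`0 < im s` is neither a trivial zero `-2(n+1)` nor the pole `1`, both of which are real
(cf. `RiemannHypothesis`, `Mathlib/NumberTheory/LSeries/RiemannZeta.lean`). [folklore] -/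
theorem RiemannHypothesisUpTo.of_riemannHypothesis (h : RiemannHypothesis) (T : ℝ) :
    RiemannHypothesisUpTo T := by
  intro s hs h0 _
  refine h s hs ?_ ?_
  · rintro ⟨n, rfl⟩
    simp at h0
  · rintro rfl
    simp at h0

/-- If RH holds up to every height, then Mathlib's `RiemannHypothesis` holds. Known: a
non-trivial zero `s ≠ 1` with `im s < 0` is handled by the conjugation symmetry
`riemannZeta_conj`, and `ζ` has no real zeros other than the trivial ones (`ζ(σ) ≠ 0` for
`0 ≤ σ < 1`, e.g. Titchmarsh, *The Theory of the Riemann Zeta-Function*, §2.12; not in Mathlib at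
the pin), whence the `sorry`. [cite: Titchmarsh1986, §2.12 (no real zeros in 0 ≤ σ < 1; conjugation symmetry)] -/
def riemannHypothesis_of_forall_riemannHypothesisUpTo : Prop :=
  ∀ (h : ∀ T, RiemannHypothesisUpTo T),
    RiemannHypothesis

/-- The two directions combined: `RiemannHypothesis ↔ ∀ T, RiemannHypothesisUpTo T`. [folklore] -/
def riemannHypothesis_iff_forall_riemannHypothesisUpTo : Prop :=
  RiemannHypothesis ↔ ∀ T, RiemannHypothesisUpTo T

/- interim proof relied on results that are now named facts (D-0014); demoted to a fact by the M5 import, proof preserved: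
:=
  ⟨RiemannHypothesisUpTo.of_riemannHypothesis, riemannHypothesis_of_forall_riemannHypothesisUpTo⟩
-/

/-- The **Platt–Trudgian numerical verification of RH** as a named hypothesis instance: RH holds
up to height `3 000 175 332 800` (D. Platt, T. Trudgian, *The Riemann hypothesis is true up to
`3 · 10¹²`*, Bull. LMS 53 (2021), 792–797, Theorem 1: "The Riemann hypothesis is true up to
height `3 000 175 332 800`. That is, the lowest `12 363 153 437 138` non-trivial zeroes `ρ` have
`Re ρ = 1/2`", where (§1) "up to height `H`" means that all zeroes `β + iγ` with `0 < γ ≤ H` have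
`β = 1/2` — the statement below; a certified ball-arithmetic computation of 7.5 million
core-hours, §2). This is statement rh.S35, carried *with its id* by
`Literature.NumberTheory.LFunctions.platt_trudgian_numerical_rh` in
`Literature/NumberTheory/LFunctions/RHWave0.lean`, of which the present named fact is a
syntactically identical restatement (the two propositions agree by `Iff.rfl`); it is restated
here only to keep this file import-light. It is the canonical instance of a named numerical
hypothesis (TRUNKS §28 design 1). Status: size XL, not discharged; the analytic reduction to the
count form `zetaZeroCount_platt_trudgian` (`N(H) ≤ 12 363 153 437 138 ≤ N₀(H)`) is proved in
`NamedHypothesesProofs.lean` (`riemannHypothesisUpTo_platt_trudgian_of_zeroCount`), and the same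
statement shape is proved outright for height `16`
(`Literature.NumberTheory.LFunctions.riemannHypothesisUpTo_sixteen`). [cite: PlattTrudgianBLMS2021, Theorem 1] -/
def riemannHypothesisUpTo_platt_trudgian : Prop :=
  RiemannHypothesisUpTo 3000175332800

/-! ### Certificate form -/

/-- A **verifier for RH up to height `T`** (`T : ℕ`): a certificate format, a Boolean checker and
a soundness proof `check T c = true → RiemannHypothesisUpTo T`, in the sense of `Literature.Analysis.ValidatedNumerics.Verifier`.
This abbreviation only fixes the statement shape by which the named hypothesis is discharged by
a verified computation (zero isolation on the critical line plus Turing's method, as in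
Platt–Trudgian 2021, §2); an instance for Backlund's method is
`Literature.NumberTheory.LFunctions.ZetaCert.backlundVerifier` (`ZetaArgumentCertificate.lean`).
[cite: PlattTrudgianBLMS2021, §2] -/
abbrev RHVerifier : Type 1 :=
  Literature.Analysis.ValidatedNumerics.Verifier.{0, 0} ℕ (fun T : ℕ ↦ RiemannHypothesisUpTo T)

/-- **Discharge route for the named hypothesis**: given a verifier `V` for RH up to integer
heights and a certificate `c` accepted by its checker at height `T`, RH holds up to height `T`
(`riemannHypothesisUpTo_of_check V c (by decide)`, without touching any downstream statement;
T-VALNUM statement shape, cf. `alerad/LeanCert`). Realised for `T = 16` in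
`ZetaArgumentCertificate.lean`; the Platt–Trudgian height is outside kernel evaluation. [folklore] -/
theorem riemannHypothesisUpTo_of_check (V : RHVerifier) {T : ℕ} (c : V.Cert)
    (h : V.check T c = true) : RiemannHypothesisUpTo (T : ℝ) :=
  V.sound h

end Literature.NumberTheory.DiophantineGeometry
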